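import Literature.MathematicalPhysics.QuantumFieldTheory.QCDTransferMatrix
import Literature.MathematicalPhysics.QuantumFieldTheory.WilsonTransferKernel
import Literature.MathematicalPhysics.QuantumLattice.GaugeGroups

/-!
# Glue between the two slice vocabularies of the Wilson `SU(3)` transfer kernel
(crux `QuarksAsStableAction.StableActionBridge`, item stmt-QuantumFields-9737, line `Sketch`;
registered stubs `gaugeSliceKernel_gaugeTransform_right` and
`wilsonSliceKernel_eq_integral_gaugeSliceKernel` of the lead skeleton)

The tree carries two descriptions of the one-step (time-slice) kernel of Wilson's lattice gauge
theory on the spatial three-torus of side `S`: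

* `WilsonTransferKernel.lean`: the temporal plaquette energy
  `sliceTemporalAction ρ U g U' = Σ_{x, i} (n − Re tr ρ(g_x U'_{x,i} g_{x+eᵢ}⁻¹ U_{x,i}⁻¹))` with
  temporal links `g`, and the Gauss-projected kernel
  `wilsonSliceKernel ρ β U U' = e^{−β S₃(U)/2} (∫ e^{−β S_tm(U, g, U')} ∏ₓ dg_x) e^{−β S₃(U')/2}`
  (Osterwalder–Seiler 1978, §2);
* `QCDTransferMatrix.lean`: the temporal-gauge kernel
  `gaugeSliceKernel β U U' = e^{−(β/2) S₃(U)} e^{−β Σₗ (3 − Re tr(U_l U'_lᴴ))} e^{−(β/2) S₃(U')}`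
  (Smit, *Introduction to Quantum Fields on a Lattice*, §4.6 (4.121)–(4.129)).

Putting the temporal links back is a gauge transformation of the second slice,
`U'^g(x,i) = g(x) U'(x,i) g(x+eᵢ)⁻¹` (`gaugeTransform`), and for `V, W ∈ SU(3)`,
`Re tr(W (V)ᴴ) = Re tr(V W⁻¹)` (`W⁻¹ = Wᴴ`, `Re tr M = Re tr Mᴴ`).  Hence

* `gaugeSliceKernel_gaugeTransform_right`:
  `K_β(U, U'^g) = e^{−β S₃(U)/2} e^{−β S_tm(U, g, U')} e^{−β S₃(U')/2}` (the spatial Wilson action is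
  gauge invariant, `wilsonAction_gaugeTransform`);
* `wilsonSliceKernel_eq_integral_gaugeSliceKernel`: integrating the temporal links against Haar,
  `wilsonSliceKernel (fundamentalRep (Fin 3)) β U U' = ∫ K_β(U, U'^g) ∏ₓ dg_x` — the Gauss-law
  projection of the temporal-gauge kernel.

[cite: Smit2023, §4.6 (4.121)–(4.137)] [cite: OsterwalderSeiler1978, §2]
-/

noncomputable section

open MeasureTheory Matrix Literature.MathematicalPhysics.QuantumFieldTheory
  Literature.MathematicalPhysics.QuantumLattice
open Literature.Probability.LatticeModels (TorusSite)

namespace Summit.QuantumFields.QCD.Cruxes.StableActionBridge.Sketch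

namespace SliceKernelGlue

/-- `Re tr M = Re tr Mᴴ`, in the form `Re tr(W Vᴴ) = Re tr(V Wᴴ)`. [folklore] -/
theorem re_trace_mul_conjTranspose_comm (V W : Matrix (Fin 3) (Fin 3) ℂ) :
    (W * Vᴴ).trace.re = (V * Wᴴ).trace.re := by
  have h : V * Wᴴ = (W * Vᴴ)ᴴ := by
    rw [Matrix.conjTranspose_mul, Matrix.conjTranspose_conjTranspose]
  rw [h, Matrix.trace_conjTranspose, Complex.star_def, Complex.conj_re]

/-- For `V, W ∈ SU(3)`: `Re tr(W Vᴴ) = Re tr ρ(V W⁻¹)`, `ρ` the fundamental representation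
(`W⁻¹ = Wᴴ` in `SU(3)`). [folklore] -/
theorem re_trace_mul_conjTranspose_eq_fundamentalRep
    (V W : Matrix.specialUnitaryGroup (Fin 3) ℂ) :
    ((W : Matrix (Fin 3) (Fin 3) ℂ) * (V : Matrix (Fin 3) (Fin 3) ℂ)ᴴ).trace.re =
      (fundamentalRep (Fin 3) (V * W⁻¹)).trace.re := by
  rw [fundamentalRep_apply, Submonoid.coe_mul, ← Matrix.star_eq_inv,
    Matrix.specialUnitaryGroup.coe_star, Matrix.star_eq_conjTranspose]
  exact re_trace_mul_conjTranspose_comm V W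

/-- The temporal-plaquette sum of `gaugeSliceKernel` against the gauge-transformed second slice
`U'^g` is the temporal plaquette energy `sliceTemporalAction` with temporal links `g`. [folklore] -/
theorem linkSum_gaugeTransform_eq_sliceTemporalAction {S : ℕ} [NeZero S]
    (U U' : GaugeConfig 3 S (Matrix.specialUnitaryGroup (Fin 3) ℂ))
    (g : TorusSite 3 S → Matrix.specialUnitaryGroup (Fin 3) ℂ) :
    ∑ l : Edge 3 S, ((3 : ℝ) - ((U l : Matrix (Fin 3) (Fin 3) ℂ) *
      (↑(gaugeTransform g U' l) : Matrix (Fin 3) (Fin 3) ℂ)ᴴ).trace.re) =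
      sliceTemporalAction (fundamentalRep (Fin 3)) U g U' := by
  unfold sliceTemporalAction
  rw [Fintype.sum_prod_type]
  refine Finset.sum_congr rfl fun x _ => Finset.sum_congr rfl fun i _ => ?_
  rw [← re_trace_mul_conjTranspose_eq_fundamentalRep, Nat.cast_ofNat]
  rfl

end SliceKernelGlue

open SliceKernelGlue

/-- **Temporal links as a gauge transformation of the second slice**: for `g : sites → SU(3)`,
`K_β(U, U'^g) = e^{−β S₃(U)/2} · e^{−β S_tm(U, g, U')} · e^{−β S₃(U')/2}`, where
`U'^g = gaugeTransform g U'`, `S_tm = sliceTemporalAction` (temporal plaquettes with temporal links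
`g`) and `S₃ = wilsonAction` of the spatial torus (gauge invariant).
[cite: Smit2023, §4.6 (4.121)–(4.137)] [cite: OsterwalderSeiler1978, §2] -/
theorem gaugeSliceKernel_gaugeTransform_right : ∀ (S : ℕ) [NeZero S] (β : ℝ) (U U' : GaugeConfig 3 S (Matrix.specialUnitaryGroup (Fin 3) ℂ)) (g : TorusSite 3 S → Matrix.specialUnitaryGroup (Fin 3) ℂ), gaugeSliceKernel β U (gaugeTransform g U') = Real.exp (-(β * wilsonAction (fundamentalRep (Fin 3)) U / 2)) * Real.exp (-(β * sliceTemporalAction (fundamentalRep (Fin 3)) U g U')) * Real.exp (-(β * wilsonAction (fundamentalRep (Fin 3)) U' / 2)) := by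
  intro S _ β U U' g
  unfold gaugeSliceKernel
  rw [linkSum_gaugeTransform_eq_sliceTemporalAction, wilsonAction_gaugeTransform]
  have h1 : -(β / 2) * wilsonAction (fundamentalRep (Fin 3)) U =
      -(β * wilsonAction (fundamentalRep (Fin 3)) U / 2) := by ring
  have h3 : -(β / 2) * wilsonAction (fundamentalRep (Fin 3)) U' =
      -(β * wilsonAction (fundamentalRep (Fin 3)) U' / 2) := by ring
  rw [h1, h3]

/-- **Gauss-law projection of the temporal-gauge kernel**: integrating the temporal links against
Haar, `wilsonSliceKernel (fundamentalRep (Fin 3)) β U U' = ∫ K_β(U, U'^g) ∏ₓ dHaar(g_x)`.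
[cite: OsterwalderSeiler1978, §2] [cite: Smit2023, §4.6 (4.127)–(4.137)] -/
theorem wilsonSliceKernel_eq_integral_gaugeSliceKernel : ∀ (S : ℕ) [NeZero S] (β : ℝ) (U U' : GaugeConfig 3 S (Matrix.specialUnitaryGroup (Fin 3) ℂ)), wilsonSliceKernel (fundamentalRep (Fin 3)) β U U' = ∫ g, gaugeSliceKernel β U (gaugeTransform g U') ∂(Measure.pi fun _ : TorusSite 3 S => haarProbability (Matrix.specialUnitaryGroup (Fin 3) ℂ)) := by
  intro S _ β U U'
  simp_rw [gaugeSliceKernel_gaugeTransform_right S β U U']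
  rw [integral_mul_const, integral_const_mul]
  rfl

end Summit.QuantumFields.QCD.Cruxes.StableActionBridge.Sketch

end
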